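import Summits.MatrixMultiplication.OmegaCensus.STPPSmallPatternNone122K2A
import Summits.MatrixMultiplication.OmegaCensus.STPPSmallPatternNone122K2B
import Summits.MatrixMultiplication.OmegaCensus.STPPSmallPatternNone122K3A
import Summits.MatrixMultiplication.OmegaCensus.STPPSmallPatternNone122K3B
import Summits.MatrixMultiplication.OmegaCensus.STPPSmallPatternNone122K3C
import Summits.MatrixMultiplication.OmegaCensus.STPPSmallPatternNone122K3D
import Summits.MatrixMultiplication.OmegaCensus.STPPSmallPatternNone122K3E
import Summits.MatrixMultiplication.OmegaCensus.STPPSmallPatternNone122K3F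
import Summits.MatrixMultiplication.OmegaCensus.STPPSmallPatternNone122K3G
import Summits.MatrixMultiplication.OmegaCensus.STPPSmallPatternNone122K3H
import Summits.MatrixMultiplication.OmegaCensus.STPPSmallPatternNone122K3I
import Summits.MatrixMultiplication.OmegaCensus.STPPSmallPatternT1Below24

/-!
# ω-census, small STPP pattern `(1,2,2)^k`: NO finite abelian group of order `≤ 23` admits `(1,2,2)³` (kernel); the `T2` onsets

HONEST FRAMING (pub-omega census; verbatim): lottery ticket; floor = certified bounds/negative ranges.
Census STRUCTURE bookkeeping of the STPP track (seat pub-omega-stpp-3, gen 23; STRUCTURE row B5: the threshold column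
`T2(H) = max {k : (1,2,2)^k ⊆ H}`, until now ENGINE ×2 on its lower sides), not progress on `ω`.

CAPSTONES of the kernel-search files `STPPSmallPatternNone122*.lean` (engine `STPPSmallPatternKernelSearch122.lean`,
reflection `STPPSmallPatternKernel{Invariant,Reflect}122.lean`), over ALL finite abelian groups, by the structure-theorem
bridge of `STPPSmallPatternT1Below24.lean` transcribed to the cardinalities `(1,2,2)`:
* `not_exists_isSTPP_122pow3_of_card_le` — **no finite abelian group of order `≤ 23` admits an STPP family of size pattern
  `(1,2,2)³`**; `ℤ/24` does (`exists_isSTPP_122pow3_zmod24`, kernel-checked witness): onset `24` exactly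
  (`stpp122pow3_onset_eq_24`);
* `not_exists_isSTPP_122pow2_of_card_le` — order `≤ 11`: no `(1,2,2)²`; `ℤ/12` hosts it (`exists_isSTPP_122pow2_zmod12`): onset `12`.
Orders below `2k` by disjointness of the `B`-pairs; every other order by the kernel theorem of its group (cyclic composite
orders through the CRT on `SeedType [q₁, q₂]`; `k = 2` cells lifted to `k = 3` by sub-families).

References: H. Cohn, R. Kleinberg, B. Szegedy, C. Umans, FOCS 2005 (arXiv:math/0511460), Def. 5.1.  Record: pub-omega HOME
`pub-omega-stpp-3-g23/`; engine cross-checks (not used): lister122.c (gen 22), desc122.c (gen 21) — T2 table of STRUCTURE.md B5.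
-/

open Literature.Computability.AlgebraicComplexity Finset

namespace Summit.MatrixMultiplication.OmegaCensus

/-! ## 1. Generic facts about the size pattern `(1,2,2)^k` -/

section Generic

variable {H P : Type*} [AddCommGroup H] [AddCommGroup P]

/-- Transport of a `(1,2,2)^k` family along an injective additive map. [cite: CohnKleinbergSzegedyUmans2005, Def. 5.1] -/
theorem exists_isSTPP_122_of_injective {k : ℕ} (φ : H →+ P) (hφ : Function.Injective φ)
    (h : ∃ A B C : Fin k → Finset H, IsSTPP A B C ∧ ∀ i, (A i).card = 1 ∧ (B i).card = 2 ∧ (C i).card = 2) :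
    ∃ A B C : Fin k → Finset P, IsSTPP A B C ∧ ∀ i, (A i).card = 1 ∧ (B i).card = 2 ∧ (C i).card = 2 := by
  classical
  obtain ⟨A, B, C, hS, hc⟩ := h
  refine ⟨fun i => (A i).image φ, fun i => (B i).image φ, fun i => (C i).image φ, hS.map_of_injective φ hφ,
    fun i => ?_⟩
  obtain ⟨hA, hB, hC⟩ := hc i
  exact ⟨by rw [card_image_of_injective _ hφ, hA], by rw [card_image_of_injective _ hφ, hB],
    by rw [card_image_of_injective _ hφ, hC]⟩

/-- Transfer of a `(1,2,2)^k` exclusion along an injective additive map between finite groups of equal cardinality.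
[cite: CohnKleinbergSzegedyUmans2005, Def. 5.1] -/
theorem not_exists_isSTPP_122_of_card_eq {k : ℕ} [Finite P] (φ : H →+ P) (hφ : Function.Injective φ)
    (hcard : Nat.card H = Nat.card P)
    (hH : ¬ ∃ A B C : Fin k → Finset H, IsSTPP A B C ∧ ∀ i, (A i).card = 1 ∧ (B i).card = 2 ∧ (C i).card = 2) :
    ¬ ∃ A B C : Fin k → Finset P, IsSTPP A B C ∧ ∀ i, (A i).card = 1 ∧ (B i).card = 2 ∧ (C i).card = 2 := by
  intro hP
  have hbij : Function.Bijective φ := hφ.bijective_of_nat_card_le (le_of_eq hcard.symm)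
  let e : H ≃+ P := AddEquiv.ofBijective φ hbij
  exact hH (exists_isSTPP_122_of_injective e.symm.toAddMonoidHom e.symm.injective hP)

/-- Fewer triples: an exclusion of `(1,2,2)^k` excludes `(1,2,2)^{k'}` for `k ≤ k'`. [folklore] -/
theorem not_exists_isSTPP_122_mono {k k' : ℕ} (hk : k ≤ k')
    (h : ¬ ∃ A B C : Fin k → Finset H, IsSTPP A B C ∧ ∀ i, (A i).card = 1 ∧ (B i).card = 2 ∧ (C i).card = 2) :
    ¬ ∃ A B C : Fin k' → Finset H, IsSTPP A B C ∧ ∀ i, (A i).card = 1 ∧ (B i).card = 2 ∧ (C i).card = 2 :=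
  not_exists_isSTPP_of_embedding (fun _ => 1) (fun _ => 2) (fun _ => 2) (fun _ => 1) (fun _ => 2) (fun _ => 2)
    (Fin.castLE hk) (Fin.castLE_injective hk) (fun _ => le_rfl) (fun _ => le_rfl) (fun _ => le_rfl) h

/-- **Packing: `2k ≤ |H|`** — the `k` pairs `Bᵢ` are pairwise disjoint (a shared `x ∈ Bᵢ ∩ Bⱼ` gives the forbidden coincidence
`x − cⱼ = x − cⱼ` with `i ≠ j`).
[cite: CohnKleinbergSzegedyUmans2005, Def. 5.1] -/
theorem two_mul_le_card_of_isSTPP_122 [Fintype H] [DecidableEq H] {k : ℕ}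
    (h : ∃ A B C : Fin k → Finset H, IsSTPP A B C ∧ ∀ i, (A i).card = 1 ∧ (B i).card = 2 ∧ (C i).card = 2) :
    2 * k ≤ Fintype.card H := by
  obtain ⟨b, b', c, c', hb, -, -, hX⟩ := exists_isSTPP_122_iff.1 h
  have hD : ∀ i j : Fin k, i ≠ j → Disjoint ({b i, b' i} : Finset H) {b j, b' j} := by
    intro i j hij
    rw [Finset.disjoint_left]
    intro x hxi hxj
    exact hX i j j (Or.inl hij) x hxi x hxj (c j) (by simp) (c j) (by simp) rfl
  have hcard : (Finset.univ.biUnion fun i : Fin k => ({b i, b' i} : Finset H)).card = 2 * k := by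
    rw [Finset.card_biUnion (fun i _ j _ hij => hD i j hij), Finset.sum_congr rfl (fun i _ => Finset.card_pair (hb i)),
      Finset.sum_const, Finset.card_univ, Fintype.card_fin, smul_eq_mul, mul_comm]
  rw [← hcard]; exact Finset.card_le_univ _

/-- Packing, `Nat.card` form. [cite: CohnKleinbergSzegedyUmans2005, Def. 5.1] -/
theorem two_mul_le_natCard_of_isSTPP_122 [Finite H] {k : ℕ}
    (h : ∃ A B C : Fin k → Finset H, IsSTPP A B C ∧ ∀ i, (A i).card = 1 ∧ (B i).card = 2 ∧ (C i).card = 2) :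
    2 * k ≤ Nat.card H := by
  classical
  cases nonempty_fintype H
  rw [Nat.card_eq_fintype_card]; exact two_mul_le_card_of_isSTPP_122 h

end Generic

/-- A `(1,2,2)^k` exclusion for `ℤ/(m n)` (`m`, `n` coprime) read on `SeedType [m, n]` (CRT). [cite: CohnKleinbergSzegedyUmans2005, Def. 5.1] -/
theorem not_exists_isSTPP_122_seedPair {m n k : ℕ} (h : m.Coprime n)
    (hneg : ¬ ∃ A B C : Fin k → Finset (ZMod (m * n)), IsSTPP A B C ∧ ∀ i, (A i).card = 1 ∧ (B i).card = 2 ∧ (C i).card = 2) :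
    ¬ ∃ A B C : Fin k → Finset (SeedType [m, n]), IsSTPP A B C ∧ ∀ i, (A i).card = 1 ∧ (B i).card = 2 ∧ (C i).card = 2 :=
  fun hex => hneg (exists_isSTPP_122_of_injective (ZMod.chineseRemainder h).symm.toAddEquiv.toAddMonoidHom
    (ZMod.chineseRemainder h).symm.injective hex)

/-! ## 2. The structure-theorem bridge for `(1,2,2)^k` -/

/-- **The bridge, `(1,2,2)` version** (transcription of `not_exists_isSTPP_211_of_card_le_hi`): a kernel domination core over
`[2k, hi]` plus the exclusions of the listed seed groups exclude every finite abelian group of order `≤ hi ≤ 23`.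
[cite: CohnKleinbergSzegedyUmans2005, Def. 5.1] -/
theorem not_exists_isSTPP_122_of_card_le_hi {k hi : ℕ} (hhi : hi ≤ 23) {L : List (List ℕ)}
    (hcore : ∀ E ∈ List.range' 1 23, ∀ M ∈ subMS (capList26 E), 2 * k ≤ M.prod → M.prod ≤ hi →
      ∃ s ∈ L, dom s M = true ∧ s.prod = M.prod)
    (hnone : ∀ s ∈ L, ¬ ∃ A B C : Fin k → Finset (SeedType s), IsSTPP A B C ∧
      ∀ i, (A i).card = 1 ∧ (B i).card = 2 ∧ (C i).card = 2)
    {G : Type*} [AddCommGroup G] [Finite G] (hG : Nat.card G ≤ hi) :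
    ¬ ∃ A B C : Fin k → Finset G, IsSTPP A B C ∧ ∀ i, (A i).card = 1 ∧ (B i).card = 2 ∧ (C i).card = 2 := by
  classical
  rintro ⟨A, B, C, hS, hc⟩
  have hlo : 2 * k ≤ Nat.card G := two_mul_le_natCard_of_isSTPP_122 ⟨A, B, C, hS, hc⟩
  obtain ⟨ι, _, p, hp, e, ⟨g⟩⟩ := AddCommGroup.equiv_directSum_zmod_of_finite G
  let f : G ≃+ (Π i, ZMod (p i ^ e i)) :=
    g.trans (DirectSum.linearEquivFunOnFintype ℕ ι (fun i => ZMod (p i ^ e i))).toAddEquiv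
  have hE1 : 1 ≤ AddMonoid.exponent G := Nat.pos_of_ne_zero AddMonoid.exponent_ne_zero_of_finite
  have hEle : AddMonoid.exponent G ≤ 23 :=
    le_trans (Nat.le_of_dvd Nat.card_pos AddGroup.exponent_dvd_nat_card) (le_trans hG hhi)
  have hdvd : ∀ i, p i ^ e i ∣ AddMonoid.exponent G := fun i => by
    have hinj : Function.Injective (AddMonoidHom.single (fun j => ZMod (p j ^ e j)) i) :=
      Pi.single_injective (M := fun j => ZMod (p j ^ e j)) i
    have h1 : addOrderOf (f.symm (AddMonoidHom.single (fun j => ZMod (p j ^ e j)) i 1)) = p i ^ e i := by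
      rw [AddEquiv.addOrderOf_eq, addOrderOf_injective _ hinj, ZMod.addOrderOf_one]
    rw [← h1]
    exact AddMonoid.addOrder_dvd_exponent _
  have hcardeq : Nat.card G = ∏ i, p i ^ e i := by
    rw [Nat.card_congr f.toEquiv, Nat.card_pi]
    simp [Nat.card_zmod]
  have hq0 : ∀ i, p i ^ e i ≠ 0 := fun i => pow_ne_zero _ (hp i).ne_zero
  haveI : ∀ i, NeZero (p i ^ e i) := fun i => ⟨hq0 i⟩
  set M : Multiset ℕ := (Finset.univ.filter fun i => 0 < e i).val.map fun i => p i ^ e i with hM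
  have hprodeq : M.prod = ∏ i, p i ^ e i := by
    rw [hM, ← Finset.prod_eq_multiset_prod]
    exact Finset.prod_filter_of_ne fun i _ hi => Nat.pos_of_ne_zero fun h0 => hi (by rw [h0, pow_zero])
  have hmem : ∀ a ∈ M, a ∈ ppList23 ∧ a ∣ AddMonoid.exponent G := by
    intro a ha
    obtain ⟨i, hi, rfl⟩ := Multiset.mem_map.1 ha
    have hi' : 0 < e i := (Finset.mem_filter.1 hi).2
    exact ⟨pow_mem_ppList23 (hp i) hi' (le_trans (Nat.le_of_dvd (by omega) (hdvd i)) hEle), hdvd i⟩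
  have hEI : AddMonoid.exponent G ∈ List.range' 1 23 := List.mem_range'_1.2 ⟨hE1, by omega⟩
  have h23 : M.prod ≤ 23 := by rw [hprodeq, ← hcardeq]; omega
  have hle : M ≤ capMS (capList26 (AddMonoid.exponent G)) :=
    le_capMS_of_prod_le hEI (fun a ha => (hmem a ha).1) (fun a ha => (hmem a ha).2) h23
  obtain ⟨s, hs, hD, hsprod⟩ := hcore _ hEI M (mem_subMS_of_le _ _ hle) (by rw [hprodeq, ← hcardeq]; exact hlo)
    (by rw [hprodeq, ← hcardeq]; exact hG)
  obtain ⟨φ, hφ, -⟩ := exists_emb_of_dom (fun i => p i ^ e i) hq0 s _ hD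
  have hcard : Nat.card (SeedType s) = Nat.card (Π i, ZMod (p i ^ e i)) := by
    rw [card_seedType, hsprod, hprodeq, Nat.card_pi]
    simp
  exact not_exists_isSTPP_122_of_card_eq φ hφ hcard (hnone s hs)
    (exists_isSTPP_122_of_injective f.toAddMonoidHom f.injective ⟨A, B, C, hS, hc⟩)

/-! ## 3. `k = 2`: order `≤ 11` -/

/-- The abelian groups of order `4 … 11`, as lists of prime-power moduli. -/
def noneLists122K2 : List (List ℕ) := [[4], [2, 2], [5], [2, 3], [7], [8], [2, 4], [2, 2, 2], [9], [3, 3], [2, 5], [11]]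

/-- COMBINATORIAL CORE for `k = 2` (kernel). -/
theorem noneList122K2_of_capped : ∀ E ∈ List.range' 1 23, ∀ M ∈ subMS (capList26 E), 2 * 2 ≤ M.prod → M.prod ≤ 11 →
    ∃ s ∈ noneLists122K2, dom s M = true ∧ s.prod = M.prod := by
  decide +kernel

/-- Each of the twelve groups admits no `(1,2,2)²` (kernel cells). [cite: CohnKleinbergSzegedyUmans2005, Def. 5.1] -/
theorem not_122pow2_of_mem_noneLists122K2 : ∀ s ∈ noneLists122K2, ¬ ∃ A B C : Fin 2 → Finset (SeedType s),
    IsSTPP A B C ∧ ∀ i, (A i).card = 1 ∧ (B i).card = 2 ∧ (C i).card = 2 := by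
  intro s hs
  simp only [noneLists122K2, List.mem_cons, List.mem_nil_iff, or_false] at hs
  rcases hs with rfl | rfl | rfl | rfl | rfl | rfl | rfl | rfl | rfl | rfl | rfl | rfl
  · exact not_exists_isSTPP_122pow2_zmod4
  · exact not_exists_isSTPP_122pow2_z2_z2
  · exact not_exists_isSTPP_122pow2_zmod5
  · exact not_exists_isSTPP_122_seedPair (by norm_num) not_exists_isSTPP_122pow2_zmod6
  · exact not_exists_isSTPP_122pow2_zmod7
  · exact not_exists_isSTPP_122pow2_zmod8
  · exact not_exists_isSTPP_122pow2_z2_z4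
  · exact not_exists_isSTPP_122pow2_z2_z2_z2
  · exact not_exists_isSTPP_122pow2_zmod9
  · exact not_exists_isSTPP_122pow2_z3_z3
  · exact not_exists_isSTPP_122_seedPair (by norm_num) not_exists_isSTPP_122pow2_zmod10
  · exact not_exists_isSTPP_122pow2_zmod11

/-- **No finite abelian group of order `≤ 11` admits `(1,2,2)²`** (kernel). [cite: CohnKleinbergSzegedyUmans2005, Def. 5.1] -/
theorem not_exists_isSTPP_122pow2_of_card_le {G : Type*} [AddCommGroup G] [Finite G] (hG : Nat.card G ≤ 11) :
    ¬ ∃ A B C : Fin 2 → Finset G, IsSTPP A B C ∧ ∀ i, (A i).card = 1 ∧ (B i).card = 2 ∧ (C i).card = 2 :=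
  not_exists_isSTPP_122_of_card_le_hi (by norm_num) noneList122K2_of_capped not_122pow2_of_mem_noneLists122K2 hG

/-- `(1,2,2)² ⊆ ℤ/12` (kernel-checked witness). [cite: CohnKleinbergSzegedyUmans2005, Def. 5.1] -/
theorem exists_isSTPP_122pow2_zmod12 :
    ∃ A B C : Fin 2 → Finset (ZMod 12), IsSTPP A B C ∧ ∀ i, (A i).card = 1 ∧ (B i).card = 2 ∧ (C i).card = 2 :=
  exists_isSTPP_of_lists_cards (H := ZMod 12) ![[0], [0]] ![[0, 1], [4, 5]] ![[0, 2], [8, 10]]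
    (by decide +kernel) (by decide +kernel)

/-- **ONSET of `(1,2,2)²` = 12** over all finite abelian groups (kernel both ways). [cite: CohnKleinbergSzegedyUmans2005, Def. 5.1] -/
theorem stpp122pow2_onset_eq_12 :
    (∀ (G : Type) [AddCommGroup G] [Finite G], Nat.card G ≤ 11 →
      ¬ ∃ A B C : Fin 2 → Finset G, IsSTPP A B C ∧ ∀ i, (A i).card = 1 ∧ (B i).card = 2 ∧ (C i).card = 2) ∧
    ∃ A B C : Fin 2 → Finset (ZMod 12), IsSTPP A B C ∧ ∀ i, (A i).card = 1 ∧ (B i).card = 2 ∧ (C i).card = 2 :=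
  ⟨fun _ _ _ hG => not_exists_isSTPP_122pow2_of_card_le hG, exists_isSTPP_122pow2_zmod12⟩

/-! ## 4. `k = 3`: order `≤ 23` -/

/-- The abelian groups of order `6 … 23`, as lists of prime-power moduli. -/
def noneLists122K3 : List (List ℕ) :=
  [[2, 3], [7], [8], [2, 4], [2, 2, 2], [9], [3, 3], [2, 5], [11], [4, 3], [2, 2, 3], [13], [2, 7], [3, 5], [16], [2, 8],
   [4, 4], [2, 2, 4], [2, 2, 2, 2], [17], [2, 9], [2, 3, 3], [19], [4, 5], [2, 2, 5], [3, 7], [2, 11], [23]]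

/-- COMBINATORIAL CORE for `k = 3` (kernel). -/
theorem noneList122K3_of_capped : ∀ E ∈ List.range' 1 23, ∀ M ∈ subMS (capList26 E), 2 * 3 ≤ M.prod → M.prod ≤ 23 →
    ∃ s ∈ noneLists122K3, dom s M = true ∧ s.prod = M.prod := by
  decide +kernel

/-- Each of the twenty-eight groups admits no `(1,2,2)³` (kernel cells; orders `6 … 11` lifted from `k = 2`).
[cite: CohnKleinbergSzegedyUmans2005, Def. 5.1] -/
theorem not_122pow3_of_mem_noneLists122K3 : ∀ s ∈ noneLists122K3, ¬ ∃ A B C : Fin 3 → Finset (SeedType s),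
    IsSTPP A B C ∧ ∀ i, (A i).card = 1 ∧ (B i).card = 2 ∧ (C i).card = 2 := by
  intro s hs
  simp only [noneLists122K3, List.mem_cons, List.mem_nil_iff, or_false] at hs
  rcases hs with rfl | rfl | rfl | rfl | rfl | rfl | rfl | rfl | rfl | rfl | rfl | rfl | rfl | rfl | rfl | rfl | rfl |
    rfl | rfl | rfl | rfl | rfl | rfl | rfl | rfl | rfl | rfl | rfl
  · exact not_exists_isSTPP_122_mono (by norm_num) (not_exists_isSTPP_122_seedPair (by norm_num) not_exists_isSTPP_122pow2_zmod6)
  · exact not_exists_isSTPP_122_mono (by norm_num) not_exists_isSTPP_122pow2_zmod7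
  · exact not_exists_isSTPP_122_mono (by norm_num) not_exists_isSTPP_122pow2_zmod8
  · exact not_exists_isSTPP_122_mono (by norm_num) not_exists_isSTPP_122pow2_z2_z4
  · exact not_exists_isSTPP_122_mono (by norm_num) not_exists_isSTPP_122pow2_z2_z2_z2
  · exact not_exists_isSTPP_122_mono (by norm_num) not_exists_isSTPP_122pow2_zmod9
  · exact not_exists_isSTPP_122_mono (by norm_num) not_exists_isSTPP_122pow2_z3_z3
  · exact not_exists_isSTPP_122_mono (by norm_num) (not_exists_isSTPP_122_seedPair (by norm_num) not_exists_isSTPP_122pow2_zmod10)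
  · exact not_exists_isSTPP_122_mono (by norm_num) not_exists_isSTPP_122pow2_zmod11
  · exact not_exists_isSTPP_122_seedPair (by norm_num) not_exists_isSTPP_122pow3_zmod12
  · exact not_exists_isSTPP_122pow3_z2_z2_z3
  · exact not_exists_isSTPP_122pow3_zmod13
  · exact not_exists_isSTPP_122_seedPair (by norm_num) not_exists_isSTPP_122pow3_zmod14
  · exact not_exists_isSTPP_122_seedPair (by norm_num) not_exists_isSTPP_122pow3_zmod15
  · exact not_exists_isSTPP_122pow3_zmod16
  · exact not_exists_isSTPP_122pow3_z2_z8
  · exact not_exists_isSTPP_122pow3_z4_z4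
  · exact not_exists_isSTPP_122pow3_z2_z2_z4
  · exact not_exists_isSTPP_122pow3_z2_z2_z2_z2
  · exact not_exists_isSTPP_122pow3_zmod17
  · exact not_exists_isSTPP_122_seedPair (by norm_num) not_exists_isSTPP_122pow3_zmod18
  · exact not_exists_isSTPP_122pow3_z2_z3_z3
  · exact not_exists_isSTPP_122pow3_zmod19
  · exact not_exists_isSTPP_122_seedPair (by norm_num) not_exists_isSTPP_122pow3_zmod20
  · exact not_exists_isSTPP_122pow3_z2_z2_z5
  · exact not_exists_isSTPP_122_seedPair (by norm_num) not_exists_isSTPP_122pow3_zmod21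
  · exact not_exists_isSTPP_122_seedPair (by norm_num) not_exists_isSTPP_122pow3_zmod22
  · exact not_exists_isSTPP_122pow3_zmod23

/-- **No finite abelian group of order `≤ 23` admits an STPP family of size pattern `(1,2,2)³`** (CKSU Def. 5.1; kernel).
No `ω` bound follows. [cite: CohnKleinbergSzegedyUmans2005, Def. 5.1] -/
theorem not_exists_isSTPP_122pow3_of_card_le {G : Type*} [AddCommGroup G] [Finite G] (hG : Nat.card G ≤ 23) :
    ¬ ∃ A B C : Fin 3 → Finset G, IsSTPP A B C ∧ ∀ i, (A i).card = 1 ∧ (B i).card = 2 ∧ (C i).card = 2 :=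
  not_exists_isSTPP_122_of_card_le_hi le_rfl noneList122K3_of_capped not_122pow3_of_mem_noneLists122K3 hG

/-- `(1,2,2)³ ⊆ ℤ/24` (kernel-checked witness; the onset). [cite: CohnKleinbergSzegedyUmans2005, Def. 5.1] -/
theorem exists_isSTPP_122pow3_zmod24 :
    ∃ A B C : Fin 3 → Finset (ZMod 24), IsSTPP A B C ∧ ∀ i, (A i).card = 1 ∧ (B i).card = 2 ∧ (C i).card = 2 :=
  exists_isSTPP_of_lists_cards (H := ZMod 24) ![[0], [0], [0]] ![[0, 1], [4, 5], [12, 13]] ![[0, 2], [8, 20], [18, 22]]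
    (by decide +kernel) (by decide +kernel)

/-- **ONSET of `(1,2,2)³` = 24** over all finite abelian groups (kernel both ways). [cite: CohnKleinbergSzegedyUmans2005, Def. 5.1] -/
theorem stpp122pow3_onset_eq_24 :
    (∀ (G : Type) [AddCommGroup G] [Finite G], Nat.card G ≤ 23 →
      ¬ ∃ A B C : Fin 3 → Finset G, IsSTPP A B C ∧ ∀ i, (A i).card = 1 ∧ (B i).card = 2 ∧ (C i).card = 2) ∧
    ∃ A B C : Fin 3 → Finset (ZMod 24), IsSTPP A B C ∧ ∀ i, (A i).card = 1 ∧ (B i).card = 2 ∧ (C i).card = 2 :=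
  ⟨fun _ _ _ hG => not_exists_isSTPP_122pow3_of_card_le hG, exists_isSTPP_122pow3_zmod24⟩

end Summit.MatrixMultiplication.OmegaCensus
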